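import Summits.BirchSwinnertonDyer.BirchSwinnertonDyer.Theorems.KolyvaginDepthDoorDepthTableKuriharaExactSides
import Summits.BirchSwinnertonDyer.BirchSwinnertonDyer.Theorems.KolyvaginDepthDoorDepthTableKuriharaSplit
import Summits.BirchSwinnertonDyer.BirchSwinnertonDyer.Theorems.KolyvaginDepthDoorDepthTableKuriharaESideFive2
import Summits.BirchSwinnertonDyer.BirchSwinnertonDyer.Theorems.KolyvaginDepthDoorDepthTableRankTwo916c1TwistBSDQuotient
import Summits.BirchSwinnertonDyer.BirchSwinnertonDyer.Theorems.KolyvaginDepthDoorDepthTableRow916c1RankDischarged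
import HarnessLib

/-!
# Route `KolyvaginDepthDoor`, crux `KolyvaginDepthSupplyKN` (stmt-BirchSwinnertonDyer-22820) —
# DEPTH TABLE v19, ROW `916c1` @ `(5, d_K = −111)` (SPLIT CELL): the SOCKET for the fleet's twist record and the EXACT
# depth-one reading in Kurihara currency (twist model `T₀ = [0, 0, 0, -49284, -1367631]` = `916c1^{(−111)}`, conductor `11286036`)

Helper file of the lead prover of line `levelone` (kdd-p1 g23; `--supports stmt-BirchSwinnertonDyer-22820
--as helper`); it closes nothing and BSD is NOT proved by it. First socket on the SPLIT (Castella–Sano) cell: `916c1`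
(`N = 916 = 2²·229`) is off W. Zhang's ♠ cell (one multiplicative prime), so the row mechanism is v17's split twin
`cruxBody_of_kuriharaClaims_split` (Castella–Sano 2026 Thm. 3, Zanarella 2019 Prop. 2.18, Howard–Zanarella BY NAME; `d_K` odd,
`p = 5` SPLIT in `K = ℚ(√−111)` as `(−111/5) = 1`).

The E-side of this row is in the tree (g21: `C916c1.sha_inf_torsionBy_five_eq_bot_of_kuriharaClaim` — `Ш(916c1)[5] = 0` from the
record `cert_916c1` @ `(5, 11·31)`, claim `hδE`); every side condition of `E = 916c1` and of the minimal twist model `T₀` at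
`p = 5` is a kernel theorem of the lineage (`goodOrdinary_5`, `hasSurjectiveModNGaloisRep_pow_5`, `nonAnomalous_5`,
`kodairaNeron_of_five_le`, `heegner_neg111`, `Rank2Observatory.C916c1.mordellWeilRank_eq_two`; `minTwist111_isElliptic/
_isGloballyMinimal/_smul_eq/_card_5/_kodairaNeron_5`). What is OWED is one datum on `T₀`:

* `minTwist111_nonAnomalous_5` — `a_5(T₀) = −3 ≢ 1 (mod 5)` (kernel: `#T̃₀(𝔽_5) = 9`).
* `cruxBody_of_twistKuriharaClaim_5_neg111` — **THE SOCKET**: for every `K` with `d_K = −111`, IF some cyclic Kolyvagin level `m`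
  of `(T₀, 5)` with `ν(m) ≤ 2` carries a unit mod-`5` Kurihara number (the CLAIM of a future tree record `cert_<T₀>` at `(5, m)`,
  hypothesis `hδT`), THEN the clause of `KolyvaginDepthSupplyKN` holds at `W = 916c1` verbatim — v17's
  `cruxBody_of_kuriharaClaims_split` with every other input discharged (E-side claim `hδE` of the existing record; Kim Thm. 1.11,
  modularity, Mazur Cor. 4.1, Castella–Sano Thm. 3, Zanarella 2.18, Howard–Zanarella BY NAME).
* `kolyvaginPrime_iff_twistKuriharaBit_5_neg111` — **THE EXACT DEPTH-ONE READING**: granted the E-side claim `hδE`, «∃ frame,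
  Kolyvagin PRIME `ℓ`, datum with `c_1(ℓ) ≠ 0`» ⟺ «for every admissible datum of `T₀`, some cyclic Kolyvagin level of `(T₀, 5)` of
  depth `≤ 1` carries a unit mod-`5` Kurihara number» — g15's `exactRow_5_neg111_rankFree` ∘ v18's
  `natCard_selmerGroup_quadraticTwist_le_iff_kuriharaBit`. The fleet's datum for this row is therefore EXACTLY one residue
  `δ̃_ℓ(T₀) mod 5` at a cyclic Kolyvagin prime `ℓ` of `(T₀, 5)` (`ℓ ∤ 5·11286036`, `ℓ ≡ 1 (mod 5)`, `a_ℓ(T₀) ≡ 2 (mod 5)`,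
  `25 ∤ #T̃₀(𝔽_ℓ)`; CLOSING-DATA-v18 §2b candidates `311★, 331★, 821★`).

CONDITIONAL on the named facts displayed and on the record claims; per curve; nothing class-wide; BSD is NOT proved by any of this.

References: [Sakamoto2022pSelmer] Thm. 1.2, Thm. 1.5; [Kim2022StructureSelmer] Thm. 1.11, §1.2.2; [CastellaSano2026] Thm. 3;
[Zanarella2019] Prop. 2.18; [Howard2004] Lemma 1.6.4; [GrossLMS1991] Prop. 3.7 (2); [Mazur1978] Cor. 4.1;
[CremonaAlgorithms1997] Table 1 (916c1); [SilvermanAEC2009] VII.3.1, X.4.2, X.5 Cor. 5.4.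
-/

set_option linter.dupNamespace false

noncomputable section

open scoped Classical NumberField

namespace Summit.BirchSwinnertonDyer.BirchSwinnertonDyer.Theorems.KolyvaginDepthDoor

open Literature.NumberTheory.EllipticCurves Literature.NumberTheory.EllipticCurves.ModularForms
  WeierstrassCurve NumberField IsDedekindDomain
open Summit.BirchSwinnertonDyer.BirchSwinnertonDyer.Theorems
open Summit.BirchSwinnertonDyer.BirchSwinnertonDyer.Rank2Observatory
open Summit.BirchSwinnertonDyer.BirchSwinnertonDyer.Rank1Residual (IntModel.frobeniusTrace_eq)

/-- An ODD prime `p` splits in a quadratic field of discriminant `D` when the Jacobi symbol `(D/p) = 1` (decomposition law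
in quadratic fields, via `satisfiesHeegnerHypothesis_iff_kronecker` at the prime level `p`). [cite: Cox2013, Prop. 5.16 and Cor. 5.17] -/
theorem satisfiesHeegnerHypothesis_prime_of_jacobiSym (K : Type) [Field K] [NumberField K]
    (h2 : Module.finrank ℚ K = 2) {D : ℤ} (hD : NumberField.discr K = D) (p : ℕ) (hp : p.Prime) (hp2 : p ≠ 2)
    (hj : jacobiSym D p = 1) : SatisfiesHeegnerHypothesis p K := by
  rw [satisfiesHeegnerHypothesis_iff_kronecker p K h2, hD]
  intro q hq hqp
  obtain rfl : q = p := (Nat.prime_dvd_prime_iff_eq hq hp).mp hqp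
  exact ⟨fun h ↦ absurd h hp2, fun _ ↦ hj⟩

namespace C916c1

/-- **`5` is non-anomalous for the twist model `T₀ = [0, 0, 0, -49284, -1367631]`**: `#T̃₀(𝔽_5) = 9`, `a_5(T₀) = −3`,
`5 ∤ a_5(T₀) − 1` (Sakamoto's hypothesis (c) / Kim's (iii) for `T₀`). [cite: SilvermanAEC2009, VII.3 Prop. 3.1] -/
theorem minTwist111_nonAnomalous_5 :
    haveI := minTwist111_isGloballyMinimal; haveI := Fact.mk (by norm_num : Nat.Prime 5);
    ¬ ((5 : ℕ) : ℤ) ∣ ((⟨0, 0, 0, -49284, -1367631⟩ : WeierstrassCurve ℤ).map (Int.castRingHom ℚ)).frobeniusTrace 5 - 1 := by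
  haveI := minTwist111_isElliptic
  haveI := minTwist111_isGloballyMinimal
  haveI := Fact.mk (by norm_num : Nat.Prime 5)
  rw [IntModel.frobeniusTrace_eq minTwist111_intModel minTwist111_card_5]
  decide

/-- **THE SOCKET for row `916c1` @ `(5, −111)` (split cell): the clause of `KolyvaginDepthSupplyKN` at `W = 916c1` from the
EXISTING E-side record claim and ONE FUTURE twist record claim.** For every imaginary quadratic `K` with `d_K = −111`: granted
Kim Thm. 1.11 (`hKim`), modularity (`hnf`), Mazur Cor. 4.1 (`hMaz`), Castella–Sano Thm. 3 (`h3`), Zanarella 2.18 (`hZ`),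
Howard–Zanarella (`hHZ`) BY NAME, the claim `hδE` of the tree record `cert_916c1` @ `(5, 341 = 11·31)`, and — THE DATUM OWED — a
cyclic Kolyvagin level `m` of `(T₀, 5)` (`hm`) of depth `ν(m) ≤ 2` (`hμ`) whose claim `hδT` holds, the crux's clause holds at
`916c1` VERBATIM (`5` split in `K`: `(−111/5) = 1`; `d_K` odd). CONDITIONAL on the six named facts and the two claims; per
curve; BSD is not proved by it. [cite: Kim2022StructureSelmer, Thm. 1.11 (PDF p. 8)] [cite: CastellaSano2026, Thm. 3 (arXiv:2601.14504 §1.1.6)]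
[cite: Zanarella2019, Prop. 2.18] [cite: Howard2004, Lemma 1.6.4] [cite: Mazur1978, Cor. 4.1] [cite: CremonaAlgorithms1997, Table 1 (916c1)] -/
theorem cruxBody_of_twistKuriharaClaim_5_neg111
    (hKim : Kim2022_card_selmerGroup_le_pow_of_kuriharaNumber_ne_zero)
    (hnf : exists_isNewformOf) (hMaz : mazur_not_dvd_maninConstant_of_odd)
    (h3 : Literature.NumberTheory.EllipticCurves.CastellaSano2026_kolyvaginClass_selmerDivisibility_eq_padicValNat_tamagawaProduct)
    (hZ : Literature.NumberTheory.EllipticCurves.Zanarella2019_kolyvaginClass_one_ne_zero_of_not_selmerDivisible)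
    (hHZ : Literature.NumberTheory.EllipticCurves.HowardZanarella_exists_minimal_kolyvaginClass_one_selmerCard_of_ne_zero)
    (K : Type) [Field K] [NumberField K] (hK : IsImaginaryQuadratic K) (hD : NumberField.discr K = -111)
    (hδE : haveI := isElliptic_c916c1; haveI := isGloballyMinimal_c916c1;
      haveI : NeZero (((⟨0, 0, 0, -4, 1⟩ : WeierstrassCurve ℤ).map (Int.castRingHom ℚ)).conductorNorm ℤ) := neZero_conductorNorm_of_isElliptic _;
      haveI := Fact.mk (by norm_num : Nat.Prime 5);
      ∀ (D : ModularParametrizationData ((⟨0, 0, 0, -4, 1⟩ : WeierstrassCurve ℤ).map (Int.castRingHom ℚ)) (((⟨0, 0, 0, -4, 1⟩ : WeierstrassCurve ℤ).map (Int.castRingHom ℚ)).conductorNorm ℤ)), ¬ ((5 : ℕ) : ℤ) ∣ D.maninConstant →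
        (∃ u : ℚ, ‖(u : ℚ_[5])‖ = 1 ∧ ((⟨0, 0, 0, -4, 1⟩ : WeierstrassCurve ℤ).map (Int.castRingHom ℚ)).realPeriodRat = u * plusPeriod D.f) →
        ∃ ψ : (ℓ : ℕ) → (ZMod ℓ)ˣ →* Multiplicative (ZMod 5),
          (∀ ℓ ∈ (341 : ℕ).primeFactors, Function.Surjective (ψ ℓ)) ∧ kuriharaNumber D.f 5 341 ψ ≠ 0)
    (m : ℕ) [NeZero m]
    (hm : haveI := minTwist111_isGloballyMinimal;
      IsCyclicKolyvaginLevel ((⟨0, 0, 0, -49284, -1367631⟩ : WeierstrassCurve ℤ).map (Int.castRingHom ℚ)) 5 m)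
    (hμ : m.primeFactors.card ≤ 2)
    (hδT : haveI := minTwist111_isElliptic; haveI := minTwist111_isGloballyMinimal;
      haveI : NeZero (((⟨0, 0, 0, -49284, -1367631⟩ : WeierstrassCurve ℤ).map (Int.castRingHom ℚ)).conductorNorm ℤ) :=
        neZero_conductorNorm_of_isElliptic _;
      haveI := Fact.mk (by norm_num : Nat.Prime 5);
      ∀ (D : ModularParametrizationData ((⟨0, 0, 0, -49284, -1367631⟩ : WeierstrassCurve ℤ).map (Int.castRingHom ℚ))
          (((⟨0, 0, 0, -49284, -1367631⟩ : WeierstrassCurve ℤ).map (Int.castRingHom ℚ)).conductorNorm ℤ)),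
        ¬ ((5 : ℕ) : ℤ) ∣ D.maninConstant →
        (∃ u : ℚ, ‖(u : ℚ_[5])‖ = 1 ∧
          ((⟨0, 0, 0, -49284, -1367631⟩ : WeierstrassCurve ℤ).map (Int.castRingHom ℚ)).realPeriodRat = u * plusPeriod D.f) →
        ∃ ψ : (ℓ : ℕ) → (ZMod ℓ)ˣ →* Multiplicative (ZMod 5),
          (∀ ℓ ∈ m.primeFactors, Function.Surjective (ψ ℓ)) ∧ kuriharaNumber D.f 5 m ψ ≠ 0) :
    haveI := isElliptic_c916c1; haveI := isGloballyMinimal_c916c1;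
    ∃ (p : ℕ) (hp : Fact p.Prime), 5 ≤ p ∧ ((⟨0, 0, 0, -4, 1⟩ : WeierstrassCurve ℤ).map (Int.castRingHom ℚ)).HasGoodReductionAtPrime p ∧
      ¬ (p : ℤ) ∣ ((⟨0, 0, 0, -4, 1⟩ : WeierstrassCurve ℤ).map (Int.castRingHom ℚ)).frobeniusTrace p ∧
      (∀ n : ℕ, ((⟨0, 0, 0, -4, 1⟩ : WeierstrassCurve ℤ).map (Int.castRingHom ℚ)).HasSurjectiveModNGaloisRep (p ^ n : ℕ)) ∧
      (∀ v : HeightOneSpectrum (𝓞 ℚ), ((⟨0, 0, 0, -4, 1⟩ : WeierstrassCurve ℤ).map (Int.castRingHom ℚ)).HasMultiplicativeReductionAt v →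
        ¬ p ∣ ((⟨0, 0, 0, -4, 1⟩ : WeierstrassCurve ℤ).map (Int.castRingHom ℚ)).ordMinimalDiscriminant v) ∧
      ∃ (K : Type) (_ : Field K) (_ : NumberField K), IsImaginaryQuadratic K ∧
        NumberField.discr K ≠ -3 ∧ NumberField.discr K ≠ -4 ∧
        ∃ (_ : NeZero (((⟨0, 0, 0, -4, 1⟩ : WeierstrassCurve ℤ).map (Int.castRingHom ℚ)).conductorNorm ℤ)),
          SatisfiesHeegnerHypothesis (((⟨0, 0, 0, -4, 1⟩ : WeierstrassCurve ℤ).map (Int.castRingHom ℚ)).conductorNorm ℤ) K ∧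
        ∃ (Dt : ModularParametrizationData ((⟨0, 0, 0, -4, 1⟩ : WeierstrassCurve ℤ).map (Int.castRingHom ℚ)) (((⟨0, 0, 0, -4, 1⟩ : WeierstrassCurve ℤ).map (Int.castRingHom ℚ)).conductorNorm ℤ))
          (β : ℤ) (ι : K →+* ℂ) (n₁ : ℕ) (d : KolyvaginHeegnerData Dt β ι n₁), Squarefree n₁ ∧
          (∀ q ∈ n₁.primeFactors, Zhang2014.IsKolyvaginPrime (((⟨0, 0, 0, -4, 1⟩ : WeierstrassCurve ℤ).map (Int.castRingHom ℚ)).conductorNorm ℤ)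
            ((⟨0, 0, 0, -4, 1⟩ : WeierstrassCurve ℤ).map (Int.castRingHom ℚ)) K p q) ∧
          d.kolyvaginClass hp.out 1 ≠ 0 ∧
          (n₁.primeFactors.card + 1 ≤ ((⟨0, 0, 0, -4, 1⟩ : WeierstrassCurve ℤ).map (Int.castRingHom ℚ)).mordellWeilRank ∨
            (n₁.primeFactors.card ≤ ((⟨0, 0, 0, -4, 1⟩ : WeierstrassCurve ℤ).map (Int.castRingHom ℚ)).mordellWeilRank ∧
              n₁.primeFactors.card + 1 ≤ (((⟨0, 0, 0, -4, 1⟩ : WeierstrassCurve ℤ).map (Int.castRingHom ℚ)).quadraticTwist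
                (NumberField.discr K : ℚ)).mordellWeilRank)) := by
  haveI := isElliptic_c916c1
  haveI := isGloballyMinimal_c916c1
  haveI iNZ : NeZero (((⟨0, 0, 0, -4, 1⟩ : WeierstrassCurve ℤ).map (Int.castRingHom ℚ)).conductorNorm ℤ) :=
    neZero_conductorNorm_of_isElliptic _
  haveI := minTwist111_isElliptic
  haveI := minTwist111_isGloballyMinimal
  haveI iNZT : NeZero (((⟨0, 0, 0, -49284, -1367631⟩ : WeierstrassCurve ℤ).map (Int.castRingHom ℚ)).conductorNorm ℤ) :=
    neZero_conductorNorm_of_isElliptic _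
  haveI iP := Fact.mk (by norm_num : Nat.Prime 5)
  haveI : NeZero (341 : ℕ) := ⟨by norm_num⟩
  have hH := satisfiesHeegnerHypothesis_conductorNorm_of_intModel intModel K hK.1 hD heegner_neg111
  have hodd : Odd (NumberField.discr K) := by rw [hD, Int.odd_iff]; norm_num
  have hD3 : NumberField.discr K ≠ -3 := by rw [hD]; norm_num
  have hD4 : NumberField.discr K ≠ -4 := by rw [hD]; norm_num
  have hpD : ¬ (((5 : ℕ) : ℤ) ∣ NumberField.discr K) := by rw [hD]; decide
  have hspl : SatisfiesHeegnerHypothesis 5 K :=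
    satisfiesHeegnerHypothesis_prime_of_jacobiSym K hK.1 hD 5 (by norm_num) (by norm_num) (by norm_num)
  have htower : ∀ k : ℕ, ((⟨0, 0, 0, -4, 1⟩ : WeierstrassCurve ℤ).map (Int.castRingHom ℚ)).HasSurjectiveModNGaloisRep ((5 : ℕ) ^ k : ℕ) :=
    hasSurjectiveModNGaloisRep_pow_5
  have hC : (⟨1, (0 : ℚ), (0 : ℚ), (0 : ℚ)⟩ : WeierstrassCurve.VariableChange ℚ) •
      ((⟨0, 0, 0, -49284, -1367631⟩ : WeierstrassCurve ℤ).map (Int.castRingHom ℚ)) =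
      ((⟨0, 0, 0, -4, 1⟩ : WeierstrassCurve ℤ).map (Int.castRingHom ℚ)).quadraticTwist (NumberField.discr K : ℚ) := by
    rw [hD]; push_cast; exact minTwist111_smul_eq
  have hr2 := Summit.BirchSwinnertonDyer.BirchSwinnertonDyer.Rank2Observatory.C916c1.mordellWeilRank_eq_two
  have hrank : 2 ≤ ((⟨0, 0, 0, -4, 1⟩ : WeierstrassCurve ℤ).map (Int.castRingHom ℚ)).mordellWeilRank := hr2.ge
  have hν' : (341 : ℕ).primeFactors.card ≤ ((⟨0, 0, 0, -4, 1⟩ : WeierstrassCurve ℤ).map (Int.castRingHom ℚ)).mordellWeilRank := by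
    rw [hr2, show (341 : ℕ) = 11 * 31 from rfl, Nat.primeFactors_mul (by norm_num) (by norm_num),
      Nat.Prime.primeFactors (by norm_num), Nat.Prime.primeFactors (by norm_num)]
    decide
  have hμ' : m.primeFactors.card ≤ ((⟨0, 0, 0, -4, 1⟩ : WeierstrassCurve ℤ).map (Int.castRingHom ℚ)).mordellWeilRank := by
    rw [hr2]; exact hμ
  exact cruxBody_of_kuriharaClaims_split hKim hnf hMaz h3 hZ hHZ _ hrank 5 le_rfl goodOrdinary_5.1 goodOrdinary_5.2 htower
    (kodairaNeron_of_five_le 5 le_rfl) nonAnomalous_5 K hK hodd hD3 hD4 hpD hspl hH 341 isCyclicKolyvaginLevel_5_341 hν' hδE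
    ((⟨0, 0, 0, -49284, -1367631⟩ : WeierstrassCurve ℤ).map (Int.castRingHom ℚ)) _ hC minTwist111_nonAnomalous_5
    minTwist111_kodairaNeron_5 m hm hμ' hδT

/-- **THE EXACT DEPTH-ONE READING of row `916c1` @ `(5, −111)` in Kurihara currency.** Granted the E-side claim `hδE`
(record `cert_916c1` @ `(5, 11·31)`; with Kim Thm. 1.11 it gives `Ш(916c1)[5] = 0`) and the named facts displayed: for every `K`
with `d_K = −111`, «some frame, some Kolyvagin PRIME `ℓ`, some Kolyvagin–Heegner datum of conductor `ℓ` with `c_1(ℓ) ≠ 0`» (the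
depth-table bit, route CHEAPEST FALSIFIER) holds IF AND ONLY IF «for every datum `D` of `T₀ = [0, 0, 0, -49284, -1367631]` at level
`N_{T₀}` with `5 ∤ c_D` and the period transfer, some cyclic Kolyvagin level `m` of `(T₀, 5)` with `ν(m) ≤ 1` carries a unit
mod-`5` Kurihara number» — `exactRow_5_neg111_rankFree` («bit ⟺ Ш(E)[5] = 0 ∧ #Sel_5(E^{(−111)}) ≤ 5», (γ) + the split-cell
print by name, rank `= 2` by kernel 2-descent) ∘ v18's twist IFF (Sakamoto Thm. 1.2/1.5 + Kim Thm. 1.11 + modularity + Mazur by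
name). So the row's missing datum is EXACTLY one residue `δ̃_ℓ(T₀) mod 5` at a cyclic Kolyvagin prime `ℓ` of `(T₀, 5)`.
CONDITIONAL on the nine named facts and the claim `hδE`; per curve; BSD is not proved by it.
[cite: Sakamoto2022pSelmer, Thm. 1.2, Thm. 1.5] [cite: Kim2022StructureSelmer, Thm. 1.11] [cite: CastellaSano2026, Thm. 3]
[cite: GrossLMS1991, Prop. 3.7 (2)] [cite: CremonaAlgorithms1997, Table 1 (916c1)] -/
theorem kolyvaginPrime_iff_twistKuriharaBit_5_neg111
    (h372 : GrossLMS1991.prop37_2_frobeniusCongruence)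
    (h3 : Literature.NumberTheory.EllipticCurves.CastellaSano2026_kolyvaginClass_selmerDivisibility_eq_padicValNat_tamagawaProduct)
    (hZ : Literature.NumberTheory.EllipticCurves.Zanarella2019_kolyvaginClass_one_ne_zero_of_not_selmerDivisible)
    (hHZ : Literature.NumberTheory.EllipticCurves.HowardZanarella_exists_minimal_kolyvaginClass_one_selmerCard_of_ne_zero)
    (hKim : Kim2022_card_selmerGroup_le_pow_of_kuriharaNumber_ne_zero)
    (hSak1 : Sakamoto2022_card_selmerGroup_eq_pow_of_isDeltaMinimal)
    (hSak2 : Sakamoto2022_exists_cyclicLevel_kuriharaNumber_ne_zero)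
    (hnf : exists_isNewformOf) (hMaz : mazur_not_dvd_maninConstant_of_odd)
    (K : Type) [Field K] [NumberField K] (hK : IsImaginaryQuadratic K) (hD : NumberField.discr K = -111)
    (hδE : haveI := isElliptic_c916c1; haveI := isGloballyMinimal_c916c1;
      haveI : NeZero (((⟨0, 0, 0, -4, 1⟩ : WeierstrassCurve ℤ).map (Int.castRingHom ℚ)).conductorNorm ℤ) := neZero_conductorNorm_of_isElliptic _;
      haveI := Fact.mk (by norm_num : Nat.Prime 5);
      ∀ (D : ModularParametrizationData ((⟨0, 0, 0, -4, 1⟩ : WeierstrassCurve ℤ).map (Int.castRingHom ℚ)) (((⟨0, 0, 0, -4, 1⟩ : WeierstrassCurve ℤ).map (Int.castRingHom ℚ)).conductorNorm ℤ)), ¬ ((5 : ℕ) : ℤ) ∣ D.maninConstant →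
        (∃ u : ℚ, ‖(u : ℚ_[5])‖ = 1 ∧ ((⟨0, 0, 0, -4, 1⟩ : WeierstrassCurve ℤ).map (Int.castRingHom ℚ)).realPeriodRat = u * plusPeriod D.f) →
        ∃ ψ : (ℓ : ℕ) → (ZMod ℓ)ˣ →* Multiplicative (ZMod 5),
          (∀ ℓ ∈ (341 : ℕ).primeFactors, Function.Surjective (ψ ℓ)) ∧ kuriharaNumber D.f 5 341 ψ ≠ 0) :
    haveI := isElliptic_c916c1; haveI := isGloballyMinimal_c916c1;
    haveI : NeZero (((⟨0, 0, 0, -4, 1⟩ : WeierstrassCurve ℤ).map (Int.castRingHom ℚ)).conductorNorm ℤ) := neZero_conductorNorm_of_isElliptic _;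
    haveI := minTwist111_isElliptic; haveI := minTwist111_isGloballyMinimal;
    haveI : NeZero (((⟨0, 0, 0, -49284, -1367631⟩ : WeierstrassCurve ℤ).map (Int.castRingHom ℚ)).conductorNorm ℤ) := neZero_conductorNorm_of_isElliptic _;
    haveI := Fact.mk (by norm_num : Nat.Prime 5);
    (∃ (Dt : ModularParametrizationData ((⟨0, 0, 0, -4, 1⟩ : WeierstrassCurve ℤ).map (Int.castRingHom ℚ)) (((⟨0, 0, 0, -4, 1⟩ : WeierstrassCurve ℤ).map (Int.castRingHom ℚ)).conductorNorm ℤ)) (β : ℤ)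
      (ι : K →+* ℂ) (ℓ : ℕ) (d : KolyvaginHeegnerData Dt β ι ℓ),
      ℓ.Prime ∧ Zhang2014.IsKolyvaginPrime (((⟨0, 0, 0, -4, 1⟩ : WeierstrassCurve ℤ).map (Int.castRingHom ℚ)).conductorNorm ℤ) ((⟨0, 0, 0, -4, 1⟩ : WeierstrassCurve ℤ).map (Int.castRingHom ℚ)) K 5 ℓ ∧
        d.kolyvaginClass (p := 5) (by norm_num) 1 ≠ 0) ↔
    (∀ (D : ModularParametrizationData ((⟨0, 0, 0, -49284, -1367631⟩ : WeierstrassCurve ℤ).map (Int.castRingHom ℚ))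
          (((⟨0, 0, 0, -49284, -1367631⟩ : WeierstrassCurve ℤ).map (Int.castRingHom ℚ)).conductorNorm ℤ)),
        ¬ ((5 : ℕ) : ℤ) ∣ D.maninConstant →
        (∃ u : ℚ, ‖(u : ℚ_[5])‖ = 1 ∧
          ((⟨0, 0, 0, -49284, -1367631⟩ : WeierstrassCurve ℤ).map (Int.castRingHom ℚ)).realPeriodRat = u * plusPeriod D.f) →
        ∃ (m : ℕ) (_ : NeZero m), IsCyclicKolyvaginLevel ((⟨0, 0, 0, -49284, -1367631⟩ : WeierstrassCurve ℤ).map (Int.castRingHom ℚ)) 5 m ∧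
          m.primeFactors.card ≤ 1 ∧
          ∃ ψ : (ℓ : ℕ) → (ZMod ℓ)ˣ →* Multiplicative (ZMod 5),
            (∀ ℓ ∈ m.primeFactors, Function.Surjective (ψ ℓ)) ∧ kuriharaNumber D.f 5 m ψ ≠ 0) := by
  haveI := isElliptic_c916c1
  haveI := isGloballyMinimal_c916c1
  haveI iNZ : NeZero (((⟨0, 0, 0, -4, 1⟩ : WeierstrassCurve ℤ).map (Int.castRingHom ℚ)).conductorNorm ℤ) :=
    neZero_conductorNorm_of_isElliptic _
  haveI := minTwist111_isElliptic
  haveI := minTwist111_isGloballyMinimal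
  haveI iNZT : NeZero (((⟨0, 0, 0, -49284, -1367631⟩ : WeierstrassCurve ℤ).map (Int.castRingHom ℚ)).conductorNorm ℤ) :=
    neZero_conductorNorm_of_isElliptic _
  haveI iP := Fact.mk (by norm_num : Nat.Prime 5)
  have hsha := sha_inf_torsionBy_five_eq_bot_of_kuriharaClaim hKim hnf hMaz hδE
  have hsur : ((⟨0, 0, 0, -4, 1⟩ : WeierstrassCurve ℤ).map (Int.castRingHom ℚ)).HasSurjectiveModNGaloisRep ((5 : ℕ) : ℤ) := by
    simpa using hasSurjectiveModNGaloisRep_pow_5 1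
  have hC : (⟨1, (0 : ℚ), (0 : ℚ), (0 : ℚ)⟩ : WeierstrassCurve.VariableChange ℚ) •
      ((⟨0, 0, 0, -49284, -1367631⟩ : WeierstrassCurve ℤ).map (Int.castRingHom ℚ)) =
      ((⟨0, 0, 0, -4, 1⟩ : WeierstrassCurve ℤ).map (Int.castRingHom ℚ)).quadraticTwist ((NumberField.discr K : ℤ) : ℚ) := by
    rw [hD]; push_cast; exact minTwist111_smul_eq
  have hpD : ¬ (((5 : ℕ) : ℤ) ∣ NumberField.discr K) := by rw [hD]; decide
  have hT := natCard_selmerGroup_quadraticTwist_le_iff_kuriharaBit hKim hSak1 hSak2 hnf hMaz _ 5 le_rfl goodOrdinary_5.1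
    goodOrdinary_5.2 hsur (NumberField.discr_ne_zero K) hpD _ _ hC minTwist111_nonAnomalous_5 minTwist111_kodairaNeron_5 1
  rw [pow_one] at hT
  rw [exactRow_5_neg111_rankFree h372 h3 hZ hHZ hnf hMaz K hK hD, and_iff_right hsha]
  exact hT

end C916c1

end Summit.BirchSwinnertonDyer.BirchSwinnertonDyer.Theorems.KolyvaginDepthDoor

end
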